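import Summits.ABC.StewartYu.PadicG3TwoSatSmall
import Summits.ABC.StewartYu.PadicG3TwoSatEnd
import Summits.ABC.StewartYu.PadicG3TwoRecordW
import HarnessLib

/-!
# Cell abc-stewartyu, WP-L.P(2) (crux r4 `PadicCoreTwoRat`, stmt-ABC-20504), record interface v2: the supplies at the PADDED coefficient
# letter `W̃ = W + c_W(d)` and the per-datum assembly **`recordSupplyTwoSatDet_of_suppliesW`**

`Summits/ABC/StewartYu/PadicG3TwoSatSupplyW.lean` — cell `abc-stewartyu` (HOME `run/shared/lean/pub/abc-stewartyu/`), route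
`YuMatveevShapeRat`, seat p3 (g10, WP-L.P(2) lead).  Definitions (`cW`, the `Prop`s `CountSupplyTwoNW`, `LinesSupplyTwoNW`,
`EndSupplyTwoNW`) and theorems; no named fact.  v2 of `PadicG3TwoSatSupply` (p561157).

WHY A PADDED LETTER.  The directional slot of the 𝔑-threaded frame is `|t|·log Xb3N` with `log Xb3N ≈ W + 2 log N + log L + 2·log((d+1)!)`
(the saturated coefficients `|b̃ₖ| ≤ (d+1)·(d+1)!·N·e^W` and the ϑ-box `(d+1)!·N·Σs` both carry the Hermite factor `(d+1)!`), and
`|t| ≤ T₀ ≈ 8(d+3)L`; the budget pays it from `X ≥ 64(n+1)·W_L/G`, which must therefore see `W_L ≥ W + 2 log((d+1)!)`: the record is the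
landed `ParTwo.parTwo V Vmax W̃` at `W̃ = W + c_W(d)`, `c_W(d) = (2d+5)(d+1)`.  The END still serves the crux at its own `W`
(`ParTwo.recordTwo_parTwo_W`), and the smallness pack absorbs the padding into the constant: `2^{111(d+1)}·(1 + c_W(d)) ≤ C(d+1)`
(e.g. `C(m) = 2^{113 m}`, as `1 + c_W(d) ≤ 4^{d+1}`).

* `cW d = (2d+5)(d+1)`, `one_add_cW_le_four_pow` (`d ≥ 1`);
* `CountSupplyTwoNW` — the Siegel count (L1N) of `schedTwoN` at `parTwo V Vmax W̃`, from the size data (stub `stub_countTwoN`);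
* `LinesSupplyTwoNW` — the GAIN branches of (L2₀)/(L2)/(L3) there (stub `stub_linesTwoN`); `gainPack_of_count_lines`;
* `EndSupplyTwoNW C` — END lines of `schedTwoN` at `parTwo V Vmax W̃` + `RecordTwo C (d+1) V Vmax W …` at the CRUX `W`;
  **`endSupplyTwoNW_of`** — proved for every admissible `C` (`0 ≤ C r`, `256^{n−r}C r ≤ C n`);
* **`recordSupplyTwoSatDet_of_suppliesW`** — `(∀ d ≥ 1, 2^{111(d+1)}(1 + c_W d) ≤ C(d+1)) → CountSupplyTwoNW → LinesSupplyTwoNW →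
  EndSupplyTwoNW C → ∀ d ≥ 1, RecordSupplyTwoSatDet C d`: per datum, the size data at `W̃`, the gain pack, lp-1's `smallPackTwoN_of_gain` (the
  smallness `‖Λ₀‖ ≤ |b̃_θ|·2^{−U}` at `U = ⌊2^{111(d+1)}∏V(W̃ + log 2Vmax)⌋₊ ≤ C(d+1)∏V(W + log 2Vmax)` from the negated bound), the END,
  then `frameNumericsTwoRASat_schedTwoN`.

WHAT THIS IS NOT: the count and the gain lines (stubs); no crux moves (A1.L not moved).

References: Yu. V. Nesterenko, LNM 1819 (2003), §3.5, §4, §5.2; K. Yu, Acta Math. 211 (2013), §3.1, §5–§6; HOME/p3/memo-13.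
-/

noncomputable section

open Finset Polynomial
open scoped Matrix Nat
open Literature.NumberTheory.Transcendental
open Literature.NumberTheory.Transcendental (FeldmanDelta.den)
open Literature.NumberTheory.Transcendental.CW77 (heightProd)
open Literature.NumberTheory.Transcendental.CW77.Setup (Tau tauNorm)
open Literature.NumberTheory.Transcendental.PadicCW77 (condExp)

namespace Summit.ABC.StewartYu

namespace TwoSetup

open Summit.ABC.StewartYu.G3Boxes

/-! ### The padding -/

/-- **The padding of the coefficient letter**: `c_W(d) = (2d+5)·(d+1)` (`≥ (2d+5)·log(d+1) + log 2`). [folklore] -/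
def cW (d : ℕ) : ℕ := (2 * d + 5) * (d + 1)

/-- `1 ≤ W + c_W(d)` for `1 ≤ W`. [folklore] -/
theorem one_le_padW {W : ℝ} (hW1 : 1 ≤ W) (d : ℕ) : 1 ≤ W + (cW d : ℝ) := by
  have : (0 : ℝ) ≤ (cW d : ℝ) := by positivity
  linarith

/-- `1 + c_W(d) ≤ 4^{d+1}` for `d ≥ 1`. [folklore] -/
theorem one_add_cW_le_four_pow {d : ℕ} (hd : 1 ≤ d) : 1 + cW d ≤ 4 ^ (d + 1) := by
  unfold cW
  induction d, hd using Nat.le_induction with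
  | base => norm_num
  | succ k hk ih =>
    have h4 : 4 ^ (k + 1 + 1) = 4 * 4 ^ (k + 1) := by rw [pow_succ]; ring
    rw [h4]
    nlinarith

/-! ### The supplies at the padded letter -/

/-- **THE COUNT SUPPLY** (Siegel over `𝔑`): for every set-up, saturation datum, weights and the size data at the crux letter `W`, the count
(L1N) of `schedTwoN` at the record `parTwo V Vmax (W + c_W d)`. [cite: Nesterenko2003, Prop 3.9 (3.48), §3.5; shape only] -/
def CountSupplyTwoNW : Prop :=
  ∀ (S : TwoSetup) (F : S.SatData) (V : Fin (S.d + 1) → ℝ) (Vmax W : ℝ),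
    1 ≤ S.d → ∀ (hV1 : ∀ j, 1 ≤ V j) (hVmax : ∀ j, V j ≤ Vmax) (hW1 : 1 ≤ W),
    (F.N : ℝ) ≤ (2 / Real.log 2) ^ (S.d + 1) * ∏ j, V j →
    2 * 2 ^ (ParTwo.parTwo V Vmax (W + cW S.d) hV1 hVmax (one_le_padW hW1 S.d)).m *
        ((2 * (ParTwo.parTwo V Vmax (W + cW S.d) hV1 hVmax (one_le_padW hW1 S.d)).X + 1) *
          (S.T03N F (ParTwo.parTwo V Vmax (W + cW S.d) hV1 hVmax (one_le_padW hW1 S.d)) 0 + S.d).choose (S.d + 1)) ≤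
      (S.L03N F (ParTwo.parTwo V Vmax (W + cW S.d) hV1 hVmax (one_le_padW hW1 S.d)) + 1) *
        (F.N * ∏ j, (2 * S.sN (ParTwo.parTwo V Vmax (W + cW S.d) hV1 hVmax (one_le_padW hW1 S.d)) j))

/-- **THE LINES SUPPLY** (the gain branches of the k-step / third-step lines): for every set-up, saturation datum, weights, basis slot
and the size data at the crux letter `W`, the three gain-branch families of `GainPackTwoN` at the record `parTwo V Vmax (W + c_W d)`.
[cite: Nesterenko2003, §4 (4.20)–(4.35)] [cite: Yu2013, Lemma 5.2 (5.40)–(5.41), Lemma 5.4; shape only] -/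
def LinesSupplyTwoNW : Prop :=
  ∀ (S : TwoSetup) (F : S.SatData) (V : Fin (S.d + 1) → ℝ) (Vmax W : ℝ) (Ucol : Fin (S.d + 1) → ℕ),
    1 ≤ S.d → ∀ (hV1 : ∀ j, 1 ≤ V j) (hVmax : ∀ j, V j ≤ Vmax) (hW1 : 1 ≤ W),
    (∀ j, Height.logHeight₁ (F.αo j) ≤ 2 * V j) →
    (∀ k, Height.logHeight₁ (S.toQ.all k) ≤ 2 * ∑ j, V j) →
    (∀ k, (|S.ball k| : ℝ) ≤ (((S.d + 1) * (S.d + 1)! : ℕ) : ℝ) * F.N * Real.exp W) →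
    (F.N : ℝ) ≤ (2 / Real.log 2) ^ (S.d + 1) * ∏ j, V j →
    (∀ j, Ucol j ≤ (S.d + 1) * F.N) →
    let P := ParTwo.parTwo V Vmax (W + cW S.d) hV1 hVmax (one_le_padW hW1 S.d)
    (∀ k, k < S.d + 3 → ∀ x₁ : ℤ, |x₁| ≤ (S.Nsub3N P 0 (k + 1) : ℤ) → ∀ τ : Tau S.d,
      tauNorm τ + S.T3N P 0 ≤ S.T03N F P 0 - k * S.T3N P 0 →
      S.Bw3N F P / (4 * (2 : ℝ) ^ P.m) ^ gainExpA (S.schedTwoN F P) 0 k <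
        1 / KTwoSat (S.schedTwoN F P) F (S.Bv3N F P) 0 x₁ τ) ∧
    (∀ I, 1 ≤ I → I ≤ S.Istar3N F P → ∀ k, k < S.d + 3 → ∀ x₁ : ℤ, |x₁| ≤ (S.Nsub3N P I (k + 1) : ℤ) →
      ∀ τ : Tau S.d, tauNorm τ + S.T3N P I ≤ S.T03N F P I - k * S.T3N P I →
      S.Bw3N F P / (4 * (2 : ℝ) ^ P.m) ^ gainExp (S.schedTwoN F P) I k <
        1 / KTwoSat (S.schedTwoN F P) F (S.Bv3N F P) I x₁ τ) ∧
    (∀ I, I < S.Istar3N F P → ∀ s : ℤ, |s| ≤ (S.Nsub3N P (I + 1) 0 : ℤ) → ¬ (3 : ℤ) ∣ s →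
      ∀ τ : Tau S.d, tauNorm τ < S.T03N F P (I + 1) →
      S.Bw3N F P / (4 * (2 : ℝ) ^ P.m) ^
          ((2 * (3 ^ (S.d + 3) * S.Xs3N P I) + 1) * (S.T03N F P I - (S.d + 3) * S.T3N P I - S.T03N F P (I + 1))) <
        1 / (6 * (thirdDenSat (S.schedTwoN F P) F (S.Bv3N F P) Ucol I s τ : ℝ) *
          thirdMSat (S.schedTwoN F P) F (S.Bv3N F P) Ucol I s τ * heightProd S.toQ.all ^ 5) ^ (3 ^ (S.d + 1 + 1) - 1))

/-- **THE END SUPPLY at the padded letter, read at the crux letter**: END lines of `schedTwoN` at `parTwo V Vmax (W + c_W d)` and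
`RecordTwo C (d+1) V Vmax W …`. [cite: Nesterenko2003, §5.2 (5.13)–(5.22); shape only] -/
def EndSupplyTwoNW (C : ℕ → ℝ) : Prop :=
  ∀ (S : TwoSetup) (F : S.SatData) (V : Fin (S.d + 1) → ℝ) (Vmax W : ℝ),
    1 ≤ S.d → ∀ (hV1 : ∀ j, 1 ≤ V j) (hVmax : ∀ j, V j ≤ Vmax) (hW1 : 1 ≤ W),
    (F.N : ℝ) ≤ (2 / Real.log 2) ^ (S.d + 1) * ∏ j, V j →
    let P := ParTwo.parTwo V Vmax (W + cW S.d) hV1 hVmax (one_le_padW hW1 S.d)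
    ∃ (S₀ X D₀' : ℕ) (D' : Fin (S.d + 1) → ℕ),
      (S.d + 1 + 1) * X ≤ (S.schedTwoN F P).Nfin (S.schedTwoN F P).Istar ∧
      (S.d + 1 + 1) * S₀ < (S.schedTwoN F P).Tfin (S.schedTwoN F P).Istar ∧
      (S.schedTwoN F P).D₀ ≤ D₀' ∧ (∀ j, S.Bv3N F P (S.schedTwoN F P).Istar j ≤ D' j) ∧
      GenThreeFrameSpecTwo.RecordTwo C (S.d + 1) V Vmax W D₀' S₀ X D'

/-! ### The gain pack from the two supplies; the END supply proved -/

/-- The gain pack at the padded record from the count and the lines. [folklore] -/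
theorem gainPack_of_count_lines (hC : CountSupplyTwoNW) (hL : LinesSupplyTwoNW) (S : TwoSetup) (F : S.SatData)
    (V : Fin (S.d + 1) → ℝ) (Vmax W : ℝ) (Ucol : Fin (S.d + 1) → ℕ) (hd : 1 ≤ S.d)
    (hV1 : ∀ j, 1 ≤ V j) (hVmax : ∀ j, V j ≤ Vmax) (hW1 : 1 ≤ W)
    (hs1 : ∀ j, Height.logHeight₁ (F.αo j) ≤ 2 * V j) (hs2 : ∀ k, Height.logHeight₁ (S.toQ.all k) ≤ 2 * ∑ j, V j)
    (hs3 : ∀ k, (|S.ball k| : ℝ) ≤ (((S.d + 1) * (S.d + 1)! : ℕ) : ℝ) * F.N * Real.exp W)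
    (hs4 : (F.N : ℝ) ≤ (2 / Real.log 2) ^ (S.d + 1) * ∏ j, V j) (hs5 : ∀ j, Ucol j ≤ (S.d + 1) * F.N) :
    S.GainPackTwoN F (ParTwo.parTwo V Vmax (W + cW S.d) hV1 hVmax (one_le_padW hW1 S.d)) Ucol := by
  obtain ⟨h0, hI, hT⟩ := hL S F V Vmax W Ucol hd hV1 hVmax hW1 hs1 hs2 hs3 hs4 hs5
  exact ⟨hC S F V Vmax W hd hV1 hVmax hW1 hs4, h0, hI, hT⟩

/-- **THE END SUPPLY, PROVED** for every admissible constant function: p5's (C1)–(C4) twin on `schedTwoN` at the padded record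
(`PadicG3TwoSatEnd`) and `RecordTwo` at the crux letter by `ParTwo.recordTwo_parTwo_W`. [cite: Nesterenko2003, §5.2; shape only] -/
theorem endSupplyTwoNW_of {C : ℕ → ℝ} (hC0 : ∀ r, 0 ≤ C r) (hCg : ∀ n r, r < n → (256 : ℝ) ^ (n - r) * C r ≤ C n) :
    EndSupplyTwoNW C := by
  intro S F V Vmax W hd hV1 hVmax hW1 _hN
  have hWt := one_le_padW hW1 S.d
  have hNq : (ParTwo.parTwo V Vmax (W + cW S.d) hV1 hVmax hWt).Nq = 2 ^ ((ParTwo.parTwo V Vmax (W + cW S.d) hV1 hVmax hWt).m + 2) := by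
    rw [ParTwo.parTwo_Nq, ParTwo.parTwo_m]
  exact ⟨_, _, _, _, S.end_range_twoN F _ hNq, S.end_order_twoN F _, S.L03N_le_D₀ F _, fun j => S.end_vbox_twoN F _ hNq j,
    ParTwo.recordTwo_parTwo_W V Vmax (W + cW S.d) hV1 hVmax hWt hd hW1 hC0 (fun r hr => hCg (S.d + 1) r hr)⟩

/-! ### The per-datum assembly -/

/-- `log (max 3 |b|) ≤ W ⇒ |b| ≤ e^W` (local copy). [folklore] -/
private theorem abs_le_exp_of_log_max_le'' {b : ℤ} {W : ℝ} (h : Real.log (max 3 (|b| : ℝ)) ≤ W) : (|b| : ℝ) ≤ Real.exp W := by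
  have h3 : (0 : ℝ) < max 3 (|b| : ℝ) := lt_of_lt_of_le (by norm_num) (le_max_left _ _)
  have := Real.exp_le_exp.mpr h
  rw [Real.exp_log h3] at this
  exact (le_max_right _ _).trans this

/-- **THE RECORD'S SUPPLY (index identity available) FROM THE COUNT, THE LINES AND THE END**, for every constant function `C` with
`0 ≤ C r` and `2^{111(d+1)}·(1 + c_W(d)) ≤ C(d+1)`.  Per crux datum and pivot-last saturated presentation: the size data (as in
`recordSupplyTwoSatDet_of_supplies`), the record at `W̃ = W + c_W(d)`, the gain pack from the two supplies, lp-1's `smallPackTwoN_of_gain`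
at `W̃` with `U = ⌊2^{111(d+1)}∏V(W̃ + log 2Vmax)⌋₊ ≤ C(d+1)∏V(W + log 2Vmax)` (so the negated bound at the CRUX letter gives the
smallness by `norm_Λ₀_ofData_sat_le`), the END at the crux letter, then `frameNumericsTwoRASat_schedTwoN`.
[cite: Yu2013, §3.1, §6; shape only] [cite: Nesterenko2003, §5] -/
theorem recordSupplyTwoSatDet_of_suppliesW {C : ℕ → ℝ}
    (hCpad : ∀ d : ℕ, 1 ≤ d → (2 : ℝ) ^ (111 * (d + 1)) * (1 + (cW d : ℝ)) ≤ C (d + 1))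
    (hCo : CountSupplyTwoNW) (hLi : LinesSupplyTwoNW) (hE : EndSupplyTwoNW C) {d : ℕ} (hd : 1 ≤ d) :
    RecordSupplyTwoSatDet C d := by
  intro α b V Vmax W hα hind hV hV1 hVmax hb hW hW1 hneg ϑ Cm U N Ucol hϑ hlast hmin hpos hN hU hα2 hϑind hαo hUC hCU hdet
    hNle hUcol1 hUcol2 hCbnd hhϑ
  -- the set-up, its saturation datum, the padded record
  set S : TwoSetup := ofData d ϑ (b ᵥ* Cm) hϑ hlast hmin with hSdef
  set F : S.SatData := satDataOf d ϑ (b ᵥ* Cm) hϑ hlast hmin (fun j => α j ^ 2) hα2 hpos U N hN hU with hFdef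
  have hdS : 1 ≤ S.d := hd
  have hWt : 1 ≤ W + (cW S.d : ℝ) := one_le_padW hW1 S.d
  set P : PadicG3Par (S.d + 1) := ParTwo.parTwo V Vmax (W + cW S.d) hV1 hVmax hWt with hPdef
  -- the size data (at the crux letter `W`, and at `W̃` for the coefficients)
  have hmaxV : ∀ j, max 1 (Height.logHeight₁ (α j)) ≤ V j := fun j => max_le (hV1 j) (hV j)
  have hs1 : ∀ j, Height.logHeight₁ (F.αo j) ≤ 2 * V j := by
    intro j
    change Height.logHeight₁ (α j ^ 2) ≤ 2 * V j
    rw [Height.logHeight₁_pow]; push_cast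
    linarith [hV j]
  have hs2 : ∀ k, Height.logHeight₁ (S.toQ.all k) ≤ 2 * ∑ j, V j := by
    intro k
    have hk : S.toQ.all k = ϑ k := congrFun (ofData_all ϑ (b ᵥ* Cm) hϑ hlast hmin) k
    rw [hk]
    refine (hhϑ k).trans ?_
    exact mul_le_mul_of_nonneg_left (Finset.sum_le_sum fun j _ => hmaxV j) (by norm_num)
  have hbW : ∀ j, (|b j| : ℝ) ≤ Real.exp W := fun j => abs_le_exp_of_log_max_le'' (hW j)
  have hs3 : ∀ k, (|S.ball k| : ℝ) ≤ (((S.d + 1) * (S.d + 1)! : ℕ) : ℝ) * F.N * Real.exp W := by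
    intro k
    have hk : S.ball k = (b ᵥ* Cm) k := congrFun (ofData_ball ϑ (b ᵥ* Cm) hϑ hlast hmin) k
    rw [hk]
    change (|(((b ᵥ* Cm) k : ℤ) : ℝ)|) ≤ (((d + 1) * (d + 1)! : ℕ) : ℝ) * (N : ℝ) * Real.exp W
    have h1 : |(b ᵥ* Cm) k| ≤ ∑ j, |b j| * ((((d + 1)! : ℕ) : ℤ) * N) := by
      simp only [Matrix.vecMul, dotProduct]
      refine (abs_sum_le_sum_abs _ _).trans (Finset.sum_le_sum fun j _ => ?_)
      rw [abs_mul]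
      exact mul_le_mul_of_nonneg_left (hCbnd j k) (abs_nonneg _)
    have h2 : (|(b ᵥ* Cm) k| : ℝ) ≤ ∑ j, (|b j| : ℝ) * ((((d + 1)! : ℕ) : ℝ) * N) := by exact_mod_cast h1
    refine h2.trans ?_
    calc ∑ j, (|b j| : ℝ) * ((((d + 1)! : ℕ) : ℝ) * N)
        ≤ ∑ _j : Fin (d + 1), Real.exp W * ((((d + 1)! : ℕ) : ℝ) * N) :=
          Finset.sum_le_sum fun j _ => mul_le_mul_of_nonneg_right (hbW j) (by positivity)
      _ = (((d + 1) * (d + 1)! : ℕ) : ℝ) * (N : ℝ) * Real.exp W := by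
          rw [Finset.sum_const, Finset.card_univ, Fintype.card_fin]; push_cast; ring
  have hs3t : ∀ k, (|S.ball k| : ℝ) ≤ (((S.d + 1) * (S.d + 1)! : ℕ) : ℝ) * F.N * Real.exp (W + cW S.d) := by
    intro k
    refine (hs3 k).trans (mul_le_mul_of_nonneg_left (Real.exp_le_exp.mpr ?_) (by positivity))
    have : (0 : ℝ) ≤ (cW S.d : ℝ) := by positivity
    linarith
  have hs4 : (F.N : ℝ) ≤ (2 / Real.log 2) ^ (S.d + 1) * ∏ j, V j := by
    change (N : ℝ) ≤ (2 / Real.log 2) ^ (d + 1) * ∏ j, V j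
    have hl : 0 < Real.log 2 := Real.log_pos one_lt_two
    have e : ∏ j : Fin (d + 1), (2 * V j / Real.log 2) = (2 / Real.log 2) ^ (d + 1) * ∏ j, V j := by
      rw [show (fun j : Fin (d + 1) => 2 * V j / Real.log 2) = fun j => (2 / Real.log 2) * V j from
        funext fun j => by ring, Finset.prod_mul_distrib, Finset.prod_const, Finset.card_univ, Fintype.card_fin]
    rw [← e]
    refine hNle.trans (Finset.prod_le_prod (fun j _ => by have := hmaxV j; positivity) fun j _ => ?_)
    exact div_le_div_of_nonneg_right (by linarith [hmaxV j]) hl.le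
  have hs5 : ∀ j, Ucol j ≤ (S.d + 1) * F.N := by
    intro j
    have := hUcol2 j
    change Ucol j ≤ (d + 1) * N
    exact_mod_cast this
  -- the gain pack at the padded record
  have hGp : S.GainPackTwoN F P Ucol := gainPack_of_count_lines hCo hLi S F V Vmax W Ucol hdS hV1 hVmax hW1 hs1 hs2 hs3 hs4 hs5
  -- the smallness: thresholds
  set T : ℝ := C (d + 1) * (∏ j, V j) * (W + Real.log (2 * Vmax)) with hTdef
  set T' : ℝ := (2 : ℝ) ^ (111 * (d + 1)) * (∏ j, V j) * (W + cW S.d + Real.log (2 * Vmax)) with hT'def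
  have hprod1 : 1 ≤ ∏ j, V j := Finset.one_le_prod fun j _ => hV1 j
  have hVmax1 : 1 ≤ Vmax := (hV1 0).trans (hVmax 0)
  have hlog : 0 < Real.log (2 * Vmax) := Real.log_pos (by linarith)
  have hcW0 : (0 : ℝ) ≤ (cW S.d : ℝ) := by positivity
  have hT'0 : 0 ≤ T' := by rw [hT'def]; positivity
  have hT'T : T' ≤ T := by
    rw [hTdef, hT'def]
    have hWl : 1 ≤ W + Real.log (2 * Vmax) := by linarith
    -- `(W̃ + ℓ) ≤ (1 + c_W)(W + ℓ)` and `2^{111 n}(1 + c_W) ≤ C n`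
    have h1 : W + cW S.d + Real.log (2 * Vmax) ≤ (1 + (cW S.d : ℝ)) * (W + Real.log (2 * Vmax)) := by nlinarith
    have h2 : (2 : ℝ) ^ (111 * (d + 1)) * (1 + (cW S.d : ℝ)) ≤ C (d + 1) := hCpad d hd
    calc (2 : ℝ) ^ (111 * (d + 1)) * (∏ j, V j) * (W + cW S.d + Real.log (2 * Vmax))
        ≤ (2 : ℝ) ^ (111 * (d + 1)) * (∏ j, V j) * ((1 + (cW S.d : ℝ)) * (W + Real.log (2 * Vmax))) :=
          mul_le_mul_of_nonneg_left h1 (by positivity)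
      _ = ((2 : ℝ) ^ (111 * (d + 1)) * (1 + (cW S.d : ℝ))) * (∏ j, V j) * (W + Real.log (2 * Vmax)) := by ring
      _ ≤ C (d + 1) * (∏ j, V j) * (W + Real.log (2 * Vmax)) := by gcongr
  set Uₙ : ℕ := ⌊T'⌋₊ with hUdef
  have hUT' : (Uₙ : ℝ) ≤ T' := Nat.floor_le hT'0
  have hTU : T' < Uₙ + 1 := Nat.lt_floor_add_one T'
  have hUT : (Uₙ : ℝ) ≤ T := hUT'.trans hT'T
  have hsmall : ‖S.Λ₀‖ ≤ |(S.bθ : ℝ)| * (2 : ℝ) ^ (-(Uₙ : ℤ)) := by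
    change ‖(ofData d ϑ (b ᵥ* Cm) hϑ hlast hmin).Λ₀‖ ≤ |(((b ᵥ* Cm) (Fin.last d) : ℤ) : ℝ)| * (2 : ℝ) ^ (-(Uₙ : ℤ))
    have h := norm_Λ₀_ofData_sat_le α ϑ hα hind b hb hϑ hϑind Cm hαo hlast hmin hneg hUT
    simpa using h
  have hΛp : S.SmallPackTwoN F P Ucol :=
    S.smallPackTwoN_of_gain F V Vmax (W + cW S.d) Ucol hdS hV1 hVmax hWt hs3t hs4 hGp (C := fun m => (2 : ℝ) ^ (111 * m))
      le_rfl Uₙ hTU hsmall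
  -- the END at the crux letter
  obtain ⟨S₀, X, D₀', D', hX, hTf, hD₀, hD, hrec⟩ := hE S F V Vmax W hdS hV1 hVmax hW1 hs4
  -- the obligation list
  have hnum := frameNumericsTwoRASat_schedTwoN (S := S) (F := F) (P := P) (Ucol := Ucol) Cm hCU hdet hCbnd hUcol1 hGp hΛp
  exact ⟨S.schedTwoN F P, S.Bv3N F P, S.Bv3N F P 0, P.H, S.L03N F P, S.famSatN F P, S₀, X, D₀', D', hnum, hΛp.slab, hX, hTf,
    hD₀, hD, hrec⟩

end TwoSetup

end Summit.ABC.StewartYu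

end
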